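import Literature.Probability.LatticeModels.GHSInequality
import HarnessLib

/-!
# The mean-field lower bound without the `ε → 0` input: averaging the marked site

Topic `Probability/LatticeModels`, namespace `Literature.CritIsing`. Sequel of
`Literature.Probability.LatticeModels.MeanFieldLowerBound`, which proves Duminil-Copin–Tassion's
eq. (2.6) (`dct_magnetization_lower_bound`, the last open input of crit-ising.S08 in the tree)
from four named facts: the corrected Lemma 2.6 (`dct_meanField_differentialInequality`), the
vanishing of its correcting boundary term along boxes (`dct_boundaryError_tendsto_zero`, "the GHS
inequality classically implies that `ε(Λ,β,h)` tends to `0`", Correction CMP 359 (2018) 821), the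
GHS concavity (`ghs_concaveOn_isingCorr_free_singleton`) and `lim_{h↘0} ⟨σ₀⟩^∅_{β,h} = m*(β)`.

This file **removes the second and the fourth fact**: it proves

* `dct_magnetization_lower_bound_of_diffIneq :
    dct_meanField_differentialInequality → ghs_concaveOn_isingCorr_free_singleton →
      dct_magnetization_lower_bound`,
* `twoPoint_exponentialDecay_of_diffIneq` (crit-ising.S08 from the same two facts),

and, feeding in the GHS concavity proved in `GHSInequality`
(`ghs_concaveOn_isingCorr_free_singleton_holds`), the hypothesis-free forms
`dct_magnetization_lower_bound_of_differentialInequality` and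
`twoPoint_exponentialDecay_of_differentialInequality`: eq. (2.6) and crit-ising.S08 rest on the
corrected Lemma 2.6 (`dct_meanField_differentialInequality`) alone.

## The two arguments

**(1) Averaging the marked site instead of `ε(Λ_n) → 0`.** Lemma 2.6 is stated at the marked
site `0` of an arbitrary finite `Λ ∋ 0`. Apply it to the translated boxes `Λ_{2n} - z`, `z ∈ Λ_n`
(so that the marked site is `z` in `Λ_{2n}`) and integrate between `a` and `b` as in
`MeanFieldLowerBound.one_sub_dctMag_sq_le` (here `one_sub_dctMag_sq_le_vol`, any `Λ ∋ 0`):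
`1 - ⟨σ_z⟩²_{Λ_{2n},b,h} ≤ exp(-∫_a^b 2c(Λ_{2n}-z)/u du) + ∫_a^b ε(Λ_{2n}-z, u, h) du`.
By Griffiths' volume monotonicity and translation covariance, uniformly in `z ∈ Λ_n`,
`⟨σ_z⟩_{Λ_{2n}} ≤ ⟨σ₀⟩_{Λ_{4n}}` and `c(Λ_{2n}-z) ≥ ⟨σ₀⟩_{Λ_n}/⟨σ₀⟩_{Λ_{4n}} =: c̃_n → 1`, while the
*average* over `z ∈ Λ_n` of the correcting terms is small: `ε(Λ_{2n}-z,u,h)` only involves the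
truncated functions `⟨σ_z;σ_x⟩_{Λ_{2n}}` with `x` on the inner boundary `∂Λ_{2n} = Λ_{2n} ∖ Λ_{2n-1}`,
so that
`∑_{z ∈ Λ_n} ε(Λ_{2n}-z,u,h) ≤ 4d ∑_{x ∈ ∂Λ_{2n}} ∑_{z ∈ Λ_{2n}} ⟨σ_x;σ_z⟩_{Λ_{2n},u,h} ≤ (8d/h) |∂Λ_{2n}|`
by the GHS susceptibility bound `∑_z ⟨σ_x;σ_z⟩_{Λ,u,h} ≤ 2/h`
(`MeanFieldLowerBound.sum_trunc_le_of_concave`, translated to the base point `x`). Since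
`|∂Λ_{2n}|/|Λ_n| → 0`, averaging gives
`1 - ⟨σ₀⟩²_{Λ_{4n},b,h} ≤ exp(-∫_a^b 2c̃_n(u)/u du) + (b-a)(8d/h)|∂Λ_{2n}|/|Λ_n|`, and `n → ∞`
yields `1 - ⟨σ₀⟩²_{b,h} ≤ (a/b)²` as before (`one_sub_dctMagInf_sq_le_avg`). This is the
classical use of the GHS inequality alluded to in the 2018 correction, organised so that only the
uniform susceptibility bound (and not the pointwise decay of `ε`) is needed.

**(2) No uniqueness at `h ≠ 0`.** Duminil-Copin–Tassion obtain `⟨σ₀⟩_{β,h} ≥ √((β²-β̃_c²)/β²)`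
for every `h > 0` *before* letting `h ↘ 0`. Since `⟨σ₀⟩^∅_{β,h} ≤ ⟨σ₀⟩⁺_{β,h}` (GKS,
`freeCorr_le_plusCorr`) and `⟨σ₀⟩⁺_{β,h} → ⟨σ₀⟩⁺_{β,0} = m*(β)` as `h ↘ 0` (right-continuity,
`plusCorr_continuousWithinAt_Ici_field`, proved in `MeanFieldLowerBound`), the bound passes to
`m*(β)` without identifying `lim_{h↘0} ⟨σ₀⟩^∅_{β,h}`.

## References

* H. Duminil-Copin, V. Tassion, CMP 343 (2016) 725, §2.4, Lemma 2.6, eqs. (2.6)–(2.10)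
  (arXiv:1502.03050 numbering); Correction, CMP 359 (2018) 821.
* S. Friedli, Y. Velenik, *Statistical Mechanics of Lattice Systems* (CUP 2017), Lemma 3.31,
  Exercises 3.12, 3.25, Remark 3.41, §3.9 p. 140.
-/

noncomputable section

open Finset Filter Topology MeasureTheory Literature.Probability.LatticeModels Literature.Probability.Percolation Set intervalIntegral
open scoped symmDiff

namespace Literature.Probability.LatticeModels

variable {d : ℕ}

/-! ### The integrated differential inequality in an arbitrary finite volume -/

section Volume

/-- `c(Λ) ≥ 0` for `β > 0`, `h > 0` and `0 ∈ Λ` (all ratios of positive one-point functions). [folklore] -/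
theorem dctRatioConst_nonneg_vol {Λ : Finset (Site d)} (h0 : (0 : Site d) ∈ Λ) {β h : ℝ}
    (hβ : 0 < β) (hh : 0 < h) : 0 ≤ dctRatioConst d Λ β h := by
  unfold dctRatioConst
  refine le_csInf ((coe_nonempty.2 ⟨0, h0⟩).image _) ?_
  rintro r ⟨y, hy, rfl⟩
  exact div_nonneg (dctCorr_singleton_pos h0 hβ hh).le (dctCorr_singleton_pos (mem_coe.1 hy) hβ hh).le

/-- **Integration of the corrected differential inequality in an arbitrary finite volume**
(Duminil-Copin–Tassion 2016, §2.4, (2.8)–(2.9), with the 2018 correction; the volume-general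
form of `one_sub_dctMag_sq_le`): for `0 < β₁ < a ≤ b`, `h > 0`, `0 ∈ Λ`, granting Lemma 2.6 and
`φ_s(S) ≥ 1` for all `s > β₁`, `S ∋ 0`,
`1 - ⟨σ₀⟩²_{Λ,b,h} ≤ exp(-∫_a^b 2c(Λ)(u)/u du) + ∫_a^b max(ε(Λ,u,h), 0) du`. [cite: DuminilCopinTassionCMP2016, §2.4, eqs. (2.8)–(2.9) (arXiv:1502.03050 numbering), with the Correction CMP 359 (2018) 821] -/
theorem one_sub_dctMag_sq_le_vol (hdi : dct_meanField_differentialInequality (d := d)) (hd : 1 ≤ d)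
    {β₁ a b h : ℝ} (hβ₁ : 0 < β₁) (ha : β₁ < a) (hab : a ≤ b) (hh : 0 < h)
    (hφ : ∀ s : ℝ, β₁ < s → ∀ S : Finset (Site d), (0 : Site d) ∈ S → 1 ≤ dctIsingPhi d s S)
    {Λ : Finset (Site d)} (h0 : (0 : Site d) ∈ Λ) :
    1 - dctMag d Λ b h ^ 2 ≤
      Real.exp (-∫ u in a..b, 2 * dctRatioConst d Λ u h / u) +
        ∫ u in a..b, max (dctBoundaryError d Λ u h) 0 := by
  have ha0 : 0 < a := hβ₁.trans ha
  set g : ℝ → ℝ := fun s => 1 - dctMag d Λ s h ^ 2 with hg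
  set k : ℝ → ℝ := fun s => 2 * dctRatioConst d Λ s h / s with hk
  set e : ℝ → ℝ := fun s => dctBoundaryError d Λ s h with he
  have hIcc : Icc a b ⊆ Ioi 0 := fun s hs => ha0.trans_le hs.1
  have hgc : ContinuousOn g (Icc a b) :=
    (continuousOn_const.sub ((continuousOn_dctCorr Λ h {0}).pow 2)).mono hIcc
  have hg' : ∀ s ∈ Ioo a b, HasDerivAt g (-deriv (fun s => dctMag d Λ s h ^ 2) s) s := by
    intro s hs
    have hs0 : s ≠ 0 := (ha0.trans hs.1).ne'
    simp only [hg]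
    exact (differentiableAt_dctMag_sq Λ hs0 h).hasDerivAt.const_sub 1
  have hkc : ContinuousOn k (Icc a b) :=
    ((continuousOn_const.mul (continuousOn_dctRatioConst ⟨0, h0⟩ hh)).div
      continuousOn_id fun s hs => (ne_of_gt hs)).mono hIcc
  have hec : ContinuousOn e (Icc a b) := (continuousOn_dctBoundaryError Λ h).mono hIcc
  have hk0 : ∀ s ∈ Icc a b, 0 ≤ k s := fun s hs =>
    div_nonneg (mul_nonneg zero_le_two (dctRatioConst_nonneg_vol h0 (ha0.trans_le hs.1) hh))
      (ha0.trans_le hs.1).le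
  have hineq : ∀ s ∈ Ioo a b, -deriv (fun s => dctMag d Λ s h ^ 2) s ≤ -k s * g s + e s := by
    intro s hs
    have hs0 : 0 < s := ha0.trans hs.1
    have hdi' := hdi hd hs0 hh h0
    have hinf : 1 ≤ ⨅ S : {S : Finset (Site d) // (0 : Site d) ∈ S}, dctIsingPhi d s S.1 := by
      haveI : Nonempty {S : Finset (Site d) // (0 : Site d) ∈ S} := ⟨⟨{0}, mem_singleton_self 0⟩⟩
      exact le_ciInf fun S => hφ s (ha.trans hs.1) S.1 S.2
    have hc0 : 0 ≤ 2 * dctRatioConst d Λ s h / s :=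
      div_nonneg (mul_nonneg zero_le_two (dctRatioConst_nonneg_vol h0 hs0 hh)) hs0.le
    have hg0 : 0 ≤ 1 - dctMag d Λ s h ^ 2 := by
      have := abs_le.1 (abs_dctCorr_le_one Λ s h {0})
      rw [dctMag]
      nlinarith
    have hmono : 2 * dctRatioConst d Λ s h / s * 1 * (1 - dctMag d Λ s h ^ 2) ≤
        2 * dctRatioConst d Λ s h / s *
            (⨅ S : {S : Finset (Site d) // (0 : Site d) ∈ S}, dctIsingPhi d s S.1) *
          (1 - dctMag d Λ s h ^ 2) := by
      rw [mul_assoc, mul_assoc]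
      exact mul_le_mul_of_nonneg_left (mul_le_mul_of_nonneg_right hinf hg0) hc0
    have := hmono.trans
      (by linarith [hdi'] : _ ≤ deriv (fun β' => dctMag d Λ β' h ^ 2) s + dctBoundaryError d Λ s h)
    simp only [hk, hg, he, mul_one] at this ⊢
    linarith
  have hG := le_mul_exp_neg_integral_add_of_deriv_le hab hgc hg' hkc hec hk0 hineq
  have hga : g a ≤ 1 := by
    simp only [hg]
    nlinarith [sq_nonneg (dctMag d Λ a h)]
  have hexp : 0 ≤ Real.exp (-∫ u in a..b, k u) := (Real.exp_pos _).le
  calc 1 - dctMag d Λ b h ^ 2 = g b := rfl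
    _ ≤ g a * Real.exp (-∫ u in a..b, k u) + ∫ u in a..b, max (e u) 0 := hG
    _ ≤ 1 * Real.exp (-∫ u in a..b, k u) + ∫ u in a..b, max (e u) 0 := by gcongr
    _ = _ := by rw [one_mul]

end Volume

/-! ### Translated boxes `Λ_{2n} - z` and translation covariance -/

section Translate

/-- Translations `addRightEmbedding z : x ↦ x + z` are automorphisms of the nearest-neighbour
graph. [cite: FriedliVelenik2017, §3.1 (translation invariance of ℤ^d)] -/
theorem zdGraph_adj_addRightEmbedding (z a b : Site d) :
    (zdGraph d).Adj (addRightEmbedding z a) (addRightEmbedding z b) ↔ (zdGraph d).Adj a b := by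
  simpa using zdGraph_adj_shift_iff z a b

/-- The translated box `Λ_{2n} - z = {x | x + z ∈ Λ_{2n}}`. [folklore] -/
def tvol (d n : ℕ) (z : Site d) : Finset (Site d) := (box d (2 * n)).map (addRightEmbedding (-z))

/-- Membership in the translated box. [folklore] -/
theorem mem_tvol {n : ℕ} {z x : Site d} : x ∈ tvol d n z ↔ x + z ∈ box d (2 * n) := by
  constructor
  · rintro h
    obtain ⟨y, hy, rfl⟩ := mem_map.1 h
    simpa using hy
  · intro h
    exact mem_map.2 ⟨x + z, h, by simp⟩

/-- Translating back: `(Λ_{2n} - z) + z = Λ_{2n}`. [folklore] -/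
theorem tvol_map_addRightEmbedding (n : ℕ) (z : Site d) : (tvol d n z).map (addRightEmbedding z) = box d (2 * n) := by
  ext x
  constructor
  · intro h
    obtain ⟨y, hy, rfl⟩ := mem_map.1 h
    simpa using mem_tvol.1 hy
  · intro h
    exact mem_map.2 ⟨x - z, mem_tvol.2 (by simpa using h), by simp⟩

/-- `0 ∈ Λ_{2n} - z` for `z ∈ Λ_{2n}`. [folklore] -/
theorem zero_mem_tvol {n : ℕ} {z : Site d} (hz : z ∈ box d (2 * n)) : (0 : Site d) ∈ tvol d n z :=
  mem_tvol.2 (by simpa using hz)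

/-- `z + w ∈ Λ_{2n}` for `z, w ∈ Λ_n`. [folklore] -/
theorem add_mem_box_two_mul {n : ℕ} {z w : Site d} (hz : z ∈ box d n) (hw : w ∈ box d n) :
    z + w ∈ box d (2 * n) := by
  rw [mem_box] at hz hw ⊢
  intro i
  have h1 := hz i; have h2 := hw i
  simp only [Pi.add_apply, Nat.cast_mul, Nat.cast_ofNat]
  constructor <;> linarith

/-- `Λ_n ⊆ Λ_{2n} - z` for `z ∈ Λ_n`. [folklore] -/
theorem box_subset_tvol {n : ℕ} {z : Site d} (hz : z ∈ box d n) : box d n ⊆ tvol d n z :=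
  fun w hw => mem_tvol.2 (by rw [add_comm]; exact add_mem_box_two_mul hz hw)

/-- `Λ_n ⊆ Λ_{2n}`. [folklore] -/
theorem box_subset_box_two_mul (n : ℕ) : box d n ⊆ box d (2 * n) :=
  box_mono d (by omega)

/-- **Translation covariance of DCT's finite-volume correlations**:
`⟨σ_A⟩_{Λ_{2n}-z,β,h} = ⟨σ_{A+z}⟩_{Λ_{2n},β,h}` (Friedli–Velenik 2017, proof of Thm. 3.17, p. 114,
relabelling by a lattice translation; tree: `isingCorr_free_map`). [cite: FriedliVelenik2017, proof of Thm. 3.17 (p. 114, Fig. 3.8) and Exercise 3.16] -/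
theorem dctCorr_tvol (n : ℕ) (z : Site d) (β h : ℝ) (A : Finset (Site d)) :
    dctCorr d (tvol d n z) β h A = dctCorr d (box d (2 * n)) β h (A.map (addRightEmbedding z)) := by
  have hmap := isingCorr_free_map (G := zdGraph d) (G' := zdGraph d) (addRightEmbedding z) (Λ := tvol d n z)
    (fun a _ b _ => zdGraph_adj_addRightEmbedding z a b) β (h / β) A
  rw [tvol_map_addRightEmbedding] at hmap
  rw [dctCorr, dctCorr, hmap]

/-- The marked site: `⟨σ₀⟩_{Λ_{2n}-z} = ⟨σ_z⟩_{Λ_{2n}}`. [folklore] -/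
theorem dctMag_tvol (n : ℕ) (z : Site d) (β h : ℝ) :
    dctMag d (tvol d n z) β h = dctCorr d (box d (2 * n)) β h {z} := by
  rw [dctMag, dctCorr_tvol, map_singleton, addRightEmbedding_apply, zero_add]

/-- One-point functions: `⟨σ_y⟩_{Λ_{2n}-z} = ⟨σ_{y+z}⟩_{Λ_{2n}}`. [folklore] -/
theorem dctCorr_tvol_singleton (n : ℕ) (z y : Site d) (β h : ℝ) :
    dctCorr d (tvol d n z) β h {y} = dctCorr d (box d (2 * n)) β h {y + z} := by
  rw [dctCorr_tvol, map_singleton, addRightEmbedding_apply]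

/-- Pair functions: `⟨σ_{{0}∆{x}}⟩_{Λ_{2n}-z} = ⟨σ_{{z}∆{x+z}}⟩_{Λ_{2n}}`. [folklore] -/
theorem dctCorr_tvol_pair (n : ℕ) (z x : Site d) (β h : ℝ) :
    dctCorr d (tvol d n z) β h ({0} ∆ {x}) = dctCorr d (box d (2 * n)) β h ({z} ∆ {x + z}) := by
  rw [dctCorr_tvol, map_eq_image, Finset.image_symmDiff _ _ (addRightEmbedding z).injective,
    Finset.image_singleton, Finset.image_singleton, addRightEmbedding_apply, addRightEmbedding_apply, zero_add]

/-! #### Uniform bounds in `z ∈ Λ_n` -/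

/-- `⟨σ₀⟩_{Λ_n} ≤ ⟨σ₀⟩_{Λ_{2n}-z}` for `z ∈ Λ_n` (`Λ_n ⊆ Λ_{2n} - z`, Griffiths). [cite: FriedliVelenik2017, Exercise 3.12, p. 112] -/
theorem dctMag_box_le_dctMag_tvol {n : ℕ} {z : Site d} (hz : z ∈ box d n) {β h : ℝ} (hβ : 0 < β)
    (hh : 0 ≤ h) : dctMag d (box d n) β h ≤ dctMag d (tvol d n z) β h := by
  rw [dctMag, dctMag, dctCorr, dctCorr]
  exact isingCorr_free_mono_volume_of_gks_two gks_two_all hβ.le (div_nonneg hh hβ.le)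
    (singleton_subset_iff.2 (zero_mem_box d n)) (box_subset_tvol hz)

/-- `⟨σ_y⟩_{Λ_{2n}-z} ≤ ⟨σ₀⟩_{Λ_{4n}}` for `y ∈ Λ_{2n} - z` (translation and eq. (2.10)). [cite: DuminilCopinTassionCMP2016, §2.4, proof of eq. (2.10) (arXiv:1502.03050 numbering)] -/
theorem dctCorr_tvol_singleton_le {n : ℕ} {z y : Site d} (hy : y ∈ tvol d n z) {β h : ℝ}
    (hβ : 0 < β) (hh : 0 ≤ h) : dctCorr d (tvol d n z) β h {y} ≤ dctMag d (box d (4 * n)) β h := by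
  rw [dctCorr_tvol_singleton, show 4 * n = 2 * (2 * n) by ring]
  exact dctCorr_singleton_le_dctMag_box (mem_tvol.1 hy) hβ hh

/-- `⟨σ₀⟩_{Λ_{2n}-z} ≤ ⟨σ₀⟩_{Λ_{4n}}` for `z ∈ Λ_{2n}`. [folklore] -/
theorem dctMag_tvol_le {n : ℕ} {z : Site d} (hz : z ∈ box d (2 * n)) {β h : ℝ} (hβ : 0 < β)
    (hh : 0 ≤ h) : dctMag d (tvol d n z) β h ≤ dctMag d (box d (4 * n)) β h :=
  dctCorr_tvol_singleton_le (zero_mem_tvol hz) hβ hh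

/-- The substitute `c̃_n(β,h) := ⟨σ₀⟩_{Λ_n,β,h}/⟨σ₀⟩_{Λ_{4n},β,h}` for `c(Λ_{2n}-z)`. [folklore] -/
def dctRatioLB (d n : ℕ) (β h : ℝ) : ℝ := dctMag d (box d n) β h / dctMag d (box d (4 * n)) β h

/-- `0 ≤ c̃_n`. [folklore] -/
theorem dctRatioLB_nonneg (n : ℕ) {β h : ℝ} (hβ : 0 < β) (hh : 0 < h) : 0 ≤ dctRatioLB d n β h :=
  div_nonneg (dctCorr_singleton_pos (zero_mem_box d n) hβ hh).le
    (dctCorr_singleton_pos (zero_mem_box d _) hβ hh).le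

/-- `c̃_n ≤ 1` (`Λ_n ⊆ Λ_{4n}`, Griffiths). [folklore] -/
theorem dctRatioLB_le_one (n : ℕ) {β h : ℝ} (hβ : 0 < β) (hh : 0 < h) : dctRatioLB d n β h ≤ 1 := by
  unfold dctRatioLB
  rw [div_le_one (show 0 < dctMag d (box d (4 * n)) β h from
    dctCorr_singleton_pos (zero_mem_box d _) hβ hh), dctMag, dctMag, dctCorr, dctCorr]
  exact isingCorr_free_mono_volume_of_gks_two gks_two_all hβ.le (div_nonneg hh.le hβ.le)
    (singleton_subset_iff.2 (zero_mem_box d n)) (box_mono d (by omega))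

/-- **`c̃_n ≤ c(Λ_{2n} - z)`** for `z ∈ Λ_n`: every ratio `⟨σ₀⟩_{Λ_{2n}-z}/⟨σ_y⟩_{Λ_{2n}-z}` has
numerator `≥ ⟨σ₀⟩_{Λ_n}` and denominator `≤ ⟨σ₀⟩_{Λ_{4n}}`. [cite: DuminilCopinTassionCMP2016, §2.4, eq. (2.10) (arXiv:1502.03050 numbering)] -/
theorem dctRatioLB_le_dctRatioConst_tvol {n : ℕ} {z : Site d} (hz : z ∈ box d n) {β h : ℝ}
    (hβ : 0 < β) (hh : 0 < h) : dctRatioLB d n β h ≤ dctRatioConst d (tvol d n z) β h := by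
  unfold dctRatioConst
  have h0 : (0 : Site d) ∈ tvol d n z := zero_mem_tvol (box_subset_box_two_mul n hz)
  refine le_csInf ((coe_nonempty.2 ⟨0, h0⟩).image _) ?_
  rintro r ⟨y, hy, rfl⟩
  have hy' : y ∈ tvol d n z := mem_coe.1 hy
  unfold dctRatioLB
  have hnum : dctMag d (box d n) β h ≤ dctMag d (tvol d n z) β h := dctMag_box_le_dctMag_tvol hz hβ hh.le
  have hden : dctCorr d (tvol d n z) β h {y} ≤ dctMag d (box d (4 * n)) β h :=
    dctCorr_tvol_singleton_le hy' hβ hh.le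
  have hnum0 : 0 ≤ dctMag d (tvol d n z) β h := (dctCorr_singleton_pos h0 hβ hh).le
  have hden0 : 0 < dctCorr d (tvol d n z) β h {y} := dctCorr_singleton_pos hy' hβ hh
  calc dctMag d (box d n) β h / dctMag d (box d (4 * n)) β h
      ≤ dctMag d (box d n) β h / dctCorr d (tvol d n z) β h {y} :=
        div_le_div_of_nonneg_left (dctCorr_singleton_pos (zero_mem_box d n) hβ hh).le hden0 hden
    _ ≤ dctMag d (tvol d n z) β h / dctCorr d (tvol d n z) β h {y} :=
        div_le_div_of_nonneg_right hnum hden0.le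

/-- `c̃_n(β,h) → 1` as `n → ∞` (`β > 0`, `h > 0`). [folklore] -/
theorem tendsto_dctRatioLB {β h : ℝ} (hβ : 0 < β) (hh : 0 < h) :
    Tendsto (fun n : ℕ => dctRatioLB d n β h) atTop (𝓝 1) := by
  have hM := tendsto_dctMag_box (d := d) hβ hh.le
  have h4 : Tendsto (fun n : ℕ => dctMag d (box d (4 * n)) β h) atTop (𝓝 (dctMagInf d β h)) :=
    hM.comp (tendsto_id.const_mul_atTop' (by norm_num : (0 : ℕ) < 4))
  have := hM.div h4 (dctMagInf_pos hβ hh).ne'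
  rwa [div_self (dctMagInf_pos hβ hh).ne'] at this

/-- Continuity of `β ↦ c̃_n(β,h)` on `(0, ∞)` for `h > 0`. [folklore] -/
theorem continuousOn_dctRatioLB (n : ℕ) {h : ℝ} (hh : 0 < h) :
    ContinuousOn (fun s => dctRatioLB d n s h) (Ioi 0) := by
  unfold dctRatioLB dctMag
  exact (continuousOn_dctCorr _ h {0}).div (continuousOn_dctCorr _ h {0}) fun s hs =>
    (dctCorr_singleton_pos (zero_mem_box d _) hs hh).ne'

end Translate

/-! ### The averaged correcting term -/

section Average

/-- **The GHS susceptibility bound at an arbitrary base point**: granting GHS concavity, for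
`β > 0`, `h > 0` and `x ∈ Λ`, `∑_{z ∈ Λ} (⟨σ_xσ_z⟩ - ⟨σ_x⟩⟨σ_z⟩)_{Λ,β,h} ≤ 2/h` (DCT's
parametrisation; `sum_trunc_le_of_concave` translated by `-x`). [folklore] -/
theorem sum_trunc_le_base (hghs : ghs_concaveOn_isingCorr_free_singleton) {Λ : Finset (Site d)}
    {x : Site d} (hx : x ∈ Λ) {β h : ℝ} (hβ : 0 < β) (hh : 0 < h) :
    ∑ z ∈ Λ, (dctCorr d Λ β h ({x} ∆ {z}) - dctCorr d Λ β h {x} * dctCorr d Λ β h {z}) ≤ 2 / h := by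
  -- the translated volume `Λ - x ∋ 0`
  set Λ' : Finset (Site d) := Λ.map (addRightEmbedding (-x)) with hΛ'
  have hmapback : Λ'.map (addRightEmbedding x) = Λ := by
    ext w
    constructor
    · intro hw
      obtain ⟨y, hy, rfl⟩ := mem_map.1 hw
      obtain ⟨u, hu, rfl⟩ := mem_map.1 hy
      simpa using hu
    · intro hw
      exact mem_map.2 ⟨w - x, mem_map.2 ⟨w, hw, by simp [sub_eq_add_neg]⟩, by simp⟩
  have h0 : (0 : Site d) ∈ Λ' := mem_map.2 ⟨x, hx, by simp⟩
  have hk : 0 < h / β := div_pos hh hβ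
  have hsum := sum_trunc_le_of_concave hghs h0 hβ hk
  rw [mul_div_cancel₀ _ hβ.ne'] at hsum
  -- transport each correlation
  have hcorr : ∀ A : Finset (Site d), isingCorr (zdGraph d) Λ' β (h / β) .free A =
      dctCorr d Λ β h (A.map (addRightEmbedding x)) := by
    intro A
    have hmap := isingCorr_free_map (G := zdGraph d) (G' := zdGraph d) (addRightEmbedding x) (Λ := Λ')
      (fun a _ b _ => zdGraph_adj_addRightEmbedding x a b) β (h / β) A
    rw [hmapback] at hmap
    rw [dctCorr, ← hmap]
  have hre := Finset.sum_map Λ' (addRightEmbedding x)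
    (fun z => dctCorr d Λ β h ({x} ∆ {z}) - dctCorr d Λ β h {x} * dctCorr d Λ β h {z})
  rw [hmapback] at hre
  rw [hre]
  calc ∑ y ∈ Λ', (dctCorr d Λ β h ({x} ∆ {addRightEmbedding x y}) -
        dctCorr d Λ β h {x} * dctCorr d Λ β h {addRightEmbedding x y})
      = ∑ y ∈ Λ', (isingCorr (zdGraph d) Λ' β (h / β) .free ({0} ∆ {y}) -
          isingCorr (zdGraph d) Λ' β (h / β) .free {0} *
            isingCorr (zdGraph d) Λ' β (h / β) .free {y}) := by
        refine sum_congr rfl fun y _ => ?_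
        rw [hcorr, hcorr, hcorr, map_singleton, map_singleton, Finset.map_eq_image,
          Finset.image_symmDiff _ _ (addRightEmbedding x).injective, Finset.image_singleton,
          Finset.image_singleton]
        simp
    _ ≤ 2 / h := hsum

/-- The inner boundary count of a site of `Λ_{2n} - z`: a site `x` whose translate `x + z` lies in
`Λ_{2n-1}` has no neighbour outside `Λ_{2n} - z` (`n ≥ 1`). [folklore] -/
theorem filter_neighbor_notMem_tvol_eq_empty {n : ℕ} (hn : 1 ≤ n) {z x : Site d}
    (hx : x + z ∈ box d (2 * n - 1)) :
    ((zdGraph d).neighborFinset x).filter (fun y => y ∉ tvol d n z) = ∅ := by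
  refine filter_eq_empty_iff.2 fun y hy hyn => hyn (mem_tvol.2 ?_)
  rw [SimpleGraph.mem_neighborFinset] at hy
  obtain ⟨i, hi⟩ := (zdGraph_adj_iff x y).1 hy
  rw [mem_box] at hx ⊢
  intro j
  have hxj := hx j
  have h2n : ((2 * n - 1 : ℕ) : ℤ) = 2 * n - 1 := by
    rw [Nat.cast_sub (by omega)]; push_cast; ring
  rw [h2n] at hxj
  simp only [Pi.add_apply, Nat.cast_mul, Nat.cast_ofNat] at hxj ⊢
  rcases hi with h | h
  · have hy' : y = x + Pi.single i 1 := h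
    subst hy'
    by_cases hij : j = i
    · subst hij; simp only [Pi.add_apply, Pi.single_eq_same]; constructor <;> linarith
    · simp only [Pi.add_apply, Pi.single_eq_of_ne hij, add_zero]; constructor <;> linarith
  · have hy' : y = x - Pi.single i 1 := by rw [h]; simp
    subst hy'
    by_cases hij : j = i
    · subst hij; simp only [Pi.sub_apply, Pi.single_eq_same]; constructor <;> linarith
    · simp only [Pi.sub_apply, Pi.single_eq_of_ne hij, sub_zero]; constructor <;> linarith

/-- **The correcting term of a translated box is carried by the inner boundary**: for `n ≥ 1`,
`z ∈ Λ_{2n}`, `β > 0`, `h ≥ 0`,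
`ε(Λ_{2n}-z,β,h) ≤ 4d ∑_{x ∈ Λ_{2n} ∖ Λ_{2n-1}} ⟨σ_z;σ_x⟩_{Λ_{2n},β,h}` (each site has at most `2d`
outside neighbours, only inner-boundary sites have any, the truncated functions are `≥ 0` by
GKS II, and translation covariance). [folklore] -/
theorem dctBoundaryError_tvol_le {n : ℕ} (hn : 1 ≤ n) {z : Site d} (hz : z ∈ box d (2 * n))
    {β h : ℝ} (hβ : 0 < β) (hh : 0 ≤ h) :
    dctBoundaryError d (tvol d n z) β h ≤
      4 * d * ∑ x ∈ annulus d (2 * n - 1) (2 * n),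
        (dctCorr d (box d (2 * n)) β h ({z} ∆ {x}) -
          dctCorr d (box d (2 * n)) β h {z} * dctCorr d (box d (2 * n)) β h {x}) := by
  have h0 : (0 : Site d) ∈ tvol d n z := zero_mem_tvol hz
  set u : Site d → ℝ := fun x => dctCorr d (tvol d n z) β h ({0} ∆ {x}) -
    dctMag d (tvol d n z) β h * dctCorr d (tvol d n z) β h {x} with hu
  have hu0 : ∀ x ∈ tvol d n z, 0 ≤ u x := fun x hx => dctCorr_trunc_nonneg h0 hx hβ.le hh
  -- step 1: bound the neighbour counts by `2d · 1[x + z ∉ Λ_{2n-1}]`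
  have hstep1 : dctBoundaryError d (tvol d n z) β h ≤
      2 * ∑ x ∈ (tvol d n z).filter (fun x => x + z ∉ box d (2 * n - 1)), (2 * d) * u x := by
    unfold dctBoundaryError
    refine mul_le_mul_of_nonneg_left ?_ zero_le_two
    rw [← sum_filter_add_sum_filter_not (tvol d n z) (fun x => x + z ∉ box d (2 * n - 1))]
    have hzero : ∑ x ∈ (tvol d n z).filter (fun x => ¬ (x + z ∉ box d (2 * n - 1))),
        ∑ _y ∈ ((zdGraph d).neighborFinset x).filter (fun y => y ∉ tvol d n z), u x = 0 := by
      refine sum_eq_zero fun x hx => ?_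
      have hx' : x + z ∈ box d (2 * n - 1) := by simpa using (mem_filter.1 hx).2
      rw [filter_neighbor_notMem_tvol_eq_empty hn hx', sum_empty]
    simp only [hu] at hzero ⊢
    rw [hzero, add_zero]
    refine sum_le_sum fun x hx => ?_
    rw [sum_const, nsmul_eq_mul]
    refine mul_le_mul_of_nonneg_right ?_ (hu0 x (mem_filter.1 hx).1)
    exact_mod_cast (card_filter_le _ _).trans (card_neighborFinset_zdGraph_le x)
  -- step 2: reindex by `x ↦ x + z` onto `Λ_{2n} ∖ Λ_{2n-1}` and translate the correlations
  have hstep2 : ∑ x ∈ (tvol d n z).filter (fun x => x + z ∉ box d (2 * n - 1)), (2 * d) * u x =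
      ∑ x ∈ annulus d (2 * n - 1) (2 * n), (2 * d) *
        (dctCorr d (box d (2 * n)) β h ({z} ∆ {x}) -
          dctCorr d (box d (2 * n)) β h {z} * dctCorr d (box d (2 * n)) β h {x}) := by
    have hset : ((tvol d n z).filter (fun x => x + z ∉ box d (2 * n - 1))).map (addRightEmbedding z) =
        annulus d (2 * n - 1) (2 * n) := by
      ext w
      simp only [Finset.mem_map, Finset.mem_filter, mem_annulus, mem_tvol, addRightEmbedding_apply]
      constructor
      · rintro ⟨x, ⟨hx1, hx2⟩, rfl⟩; exact ⟨hx1, hx2⟩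
      · rintro ⟨hw1, hw2⟩; exact ⟨w - z, ⟨by simpa using hw1, by simpa using hw2⟩, by simp⟩
    rw [← hset, sum_map]
    refine sum_congr rfl fun x _ => ?_
    simp only [hu, addRightEmbedding_apply]
    rw [dctCorr_tvol_pair, dctMag_tvol, dctCorr_tvol_singleton]
  rw [hstep2] at hstep1
  refine hstep1.trans (le_of_eq ?_)
  rw [← mul_sum]
  ring

/-- **The averaged correcting term is of boundary order**: granting GHS concavity, for `n ≥ 1`,
`β > 0`, `h > 0`, `∑_{z ∈ Λ_n} ε(Λ_{2n}-z,β,h) ≤ (8d/h) |Λ_{2n} ∖ Λ_{2n-1}|` (exchange the sums,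
enlarge `z ∈ Λ_n` to `z ∈ Λ_{2n}` by GKS II, and bound each susceptibility by `2/h`). [folklore] -/
theorem sum_dctBoundaryError_tvol_le (hghs : ghs_concaveOn_isingCorr_free_singleton) {n : ℕ}
    (hn : 1 ≤ n) {β h : ℝ} (hβ : 0 < β) (hh : 0 < h) :
    ∑ z ∈ box d n, dctBoundaryError d (tvol d n z) β h ≤
      8 * d / h * #(annulus d (2 * n - 1) (2 * n)) := by
  set Λ := box d (2 * n) with hΛ
  set u2 : Site d → Site d → ℝ := fun x z =>
    dctCorr d Λ β h ({x} ∆ {z}) - dctCorr d Λ β h {x} * dctCorr d Λ β h {z} with hu2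
  have hsymm : ∀ x z, u2 z x = u2 x z := by
    intro x z; simp only [hu2]; rw [symmDiff_comm, mul_comm]
  have hu2_nonneg : ∀ x ∈ Λ, ∀ z ∈ Λ, 0 ≤ u2 x z := by
    intro x hx z hz
    simp only [hu2, sub_nonneg, dctCorr]
    exact gks_two_all (zdGraph d) Λ {x} {z} β (h / β) .free hβ.le (div_nonneg hh.le hβ.le) (Or.inl rfl)
      (singleton_subset_iff.2 hx) (singleton_subset_iff.2 hz)
  calc ∑ z ∈ box d n, dctBoundaryError d (tvol d n z) β h
      ≤ ∑ z ∈ box d n, 4 * d * ∑ x ∈ annulus d (2 * n - 1) (2 * n), u2 z x :=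
        sum_le_sum fun z hz => dctBoundaryError_tvol_le hn (box_subset_box_two_mul n hz) hβ hh.le
    _ = 4 * d * ∑ x ∈ annulus d (2 * n - 1) (2 * n), ∑ z ∈ box d n, u2 x z := by
        rw [← mul_sum, sum_comm]
        simp only [hsymm]
    _ ≤ 4 * d * ∑ x ∈ annulus d (2 * n - 1) (2 * n), ∑ z ∈ Λ, u2 x z := by
        refine mul_le_mul_of_nonneg_left (sum_le_sum fun x hx => ?_) (by positivity)
        exact sum_le_sum_of_subset_of_nonneg (box_subset_box_two_mul n) fun z hz _ =>
          hu2_nonneg x (mem_annulus.1 hx).1 z hz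
    _ ≤ 4 * d * ∑ _x ∈ annulus d (2 * n - 1) (2 * n), 2 / h := by
        refine mul_le_mul_of_nonneg_left (sum_le_sum fun x hx => ?_) (by positivity)
        exact sum_trunc_le_base hghs (mem_annulus.1 hx).1 hβ hh
    _ = 8 * d / h * #(annulus d (2 * n - 1) (2 * n)) := by
        rw [sum_const, nsmul_eq_mul]
        ring

/-- The boundary-to-volume ratio `|Λ_{2n} ∖ Λ_{2n-1}| / |Λ_n| → 0`. [folklore] -/
theorem tendsto_card_boundary_div_card_box (hd : 1 ≤ d) :
    Tendsto (fun n : ℕ => (#(annulus d (2 * n - 1) (2 * n)) : ℝ) / #(box d n)) atTop (𝓝 0) := by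
  -- explicit bound `≤ d 2^d / (2n+1)` for `n ≥ 1`
  have hbound : ∀ n : ℕ, 1 ≤ n →
      (#(annulus d (2 * n - 1) (2 * n)) : ℝ) / #(box d n) ≤ d * 2 ^ d / (2 * n + 1) := by
    intro n hn
    have hsub : box d (2 * n - 1) ⊆ box d (2 * n) := box_mono d (by omega)
    unfold annulus
    rw [card_sdiff_of_subset hsub, card_box, card_box, card_box,
      Nat.cast_sub (Nat.pow_le_pow_left (by omega) d)]
    have hcast : ((2 * n - 1 : ℕ) : ℝ) = 2 * n - 1 := by
      rw [Nat.cast_sub (by omega)]; push_cast; ring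
    push_cast
    rw [hcast]
    set A : ℝ := 2 * (2 * (n : ℝ)) + 1 with hA
    set B : ℝ := 2 * (2 * (n : ℝ) - 1) + 1 with hB
    have hn' : (1 : ℝ) ≤ n := by exact_mod_cast hn
    have hB0 : 0 ≤ B := by simp only [hB]; linarith
    have hBA : B ≤ A := by simp only [hA, hB]; linarith
    have hAB2 : A - B = 2 := by simp only [hA, hB]; ring
    have hA' : A ≤ 2 * (2 * (n : ℝ) + 1) := by simp only [hA]; linarith
    have hA0 : 0 ≤ A := hB0.trans hBA
    have hdiff : A ^ d - B ^ d ≤ 2 * (d * A ^ (d - 1)) := by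
      calc A ^ d - B ^ d ≤ |A ^ d - B ^ d| := le_abs_self _
        _ ≤ |A - B| * d * max |A| |B| ^ (d - 1) := abs_pow_sub_pow_le A B d
        _ = 2 * (d * A ^ (d - 1)) := by
            rw [abs_of_nonneg (sub_nonneg.2 hBA), abs_of_nonneg hA0, abs_of_nonneg hB0, max_eq_left hBA,
              hAB2]
            ring
    have hapow : A ^ (d - 1) ≤ (2 : ℝ) ^ (d - 1) * (2 * n + 1) ^ (d - 1) := by
      rw [← mul_pow]
      exact pow_le_pow_left₀ hA0 hA' _
    have hpos : (0 : ℝ) < (2 * (n : ℝ) + 1) ^ d := by positivity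
    rw [div_le_div_iff₀ hpos (by positivity)]
    have hsplit : (2 * (n : ℝ) + 1) ^ d = (2 * n + 1) ^ (d - 1) * (2 * n + 1) := by
      rw [← pow_succ]; congr 1; omega
    have h2d : (2 : ℝ) ^ d = 2 * 2 ^ (d - 1) := by
      rw [← pow_succ']; congr 1; omega
    calc (A ^ d - B ^ d) * (2 * n + 1) ≤ 2 * (d * A ^ (d - 1)) * (2 * n + 1) := by gcongr
      _ ≤ 2 * (d * ((2 : ℝ) ^ (d - 1) * (2 * n + 1) ^ (d - 1))) * (2 * n + 1) := by gcongr
      _ = d * 2 ^ d * (2 * n + 1) ^ d := by rw [hsplit, h2d]; ring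
  have hlim : Tendsto (fun n : ℕ => (d : ℝ) * 2 ^ d / (2 * n + 1)) atTop (𝓝 0) := by
    have h1 : Tendsto (fun n : ℕ => (2 * (n : ℝ) + 1)) atTop atTop :=
      tendsto_atTop_add_const_right _ 1 (tendsto_natCast_atTop_atTop.const_mul_atTop two_pos)
    exact tendsto_const_nhds.div_atTop h1
  refine squeeze_zero' (Eventually.of_forall fun n => by positivity)
    ((eventually_ge_atTop 1).mono fun n hn => hbound n hn) hlim

end Average

/-! ### The limit `n → ∞` of the averaged inequality -/

section Limit

/-- **The averaged integrated inequality**: granting the corrected Lemma 2.6 and GHS concavity, for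
`0 < β₁ < a ≤ b`, `h > 0`, `n ≥ 1` and `φ_s(S) ≥ 1` (`s > β₁`, `S ∋ 0`),
`1 - ⟨σ₀⟩²_{Λ_{4n},b,h} ≤ exp(-∫_a^b 2c̃_n(u)/u du) + (b - a) (8d/h) |Λ_{2n} ∖ Λ_{2n-1}| / |Λ_n|`. [cite: DuminilCopinTassionCMP2016, §2.4, eqs. (2.8)–(2.10) (arXiv:1502.03050 numbering), with the Correction CMP 359 (2018) 821] -/
theorem one_sub_dctMag_sq_le_avg (hdi : dct_meanField_differentialInequality (d := d))
    (hghs : ghs_concaveOn_isingCorr_free_singleton) (hd : 1 ≤ d)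
    {β₁ a b h : ℝ} (hβ₁ : 0 < β₁) (ha : β₁ < a) (hab : a ≤ b) (hh : 0 < h)
    (hφ : ∀ s : ℝ, β₁ < s → ∀ S : Finset (Site d), (0 : Site d) ∈ S → 1 ≤ dctIsingPhi d s S)
    {n : ℕ} (hn : 1 ≤ n) :
    1 - dctMag d (box d (4 * n)) b h ^ 2 ≤
      Real.exp (-∫ u in a..b, 2 * dctRatioLB d n u h / u) +
        (b - a) * (8 * d / h * (#(annulus d (2 * n - 1) (2 * n)) / #(box d n))) := by
  have ha0 : 0 < a := hβ₁.trans ha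
  have hb0 : 0 < b := ha0.trans_le hab
  have hIcc : ∀ u ∈ Icc a b, 0 < u := fun u hu => ha0.trans_le hu.1
  set E : ℝ := Real.exp (-∫ u in a..b, 2 * dctRatioLB d n u h / u) with hE
  -- the inequality for each translated box
  have hz_ineq : ∀ z ∈ box d n, 1 - dctMag d (box d (4 * n)) b h ^ 2 ≤
      E + ∫ u in a..b, dctBoundaryError d (tvol d n z) u h := by
    intro z hz
    have hz2 : z ∈ box d (2 * n) := box_subset_box_two_mul n hz
    have h0 : (0 : Site d) ∈ tvol d n z := zero_mem_tvol hz2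
    have hvol := one_sub_dctMag_sq_le_vol hdi hd hβ₁ ha hab hh hφ h0
    -- LHS comparison
    have hM : dctMag d (tvol d n z) b h ≤ dctMag d (box d (4 * n)) b h := dctMag_tvol_le hz2 hb0 hh.le
    have hM0 : 0 ≤ dctMag d (tvol d n z) b h := (dctCorr_singleton_pos h0 hb0 hh).le
    have hLHS : 1 - dctMag d (box d (4 * n)) b h ^ 2 ≤ 1 - dctMag d (tvol d n z) b h ^ 2 := by
      nlinarith
    -- the exponential term: `c̃_n ≤ c(Λ_{2n} - z)` pointwise, both continuous
    have hint1 : IntervalIntegrable (fun u => 2 * dctRatioLB d n u h / u) volume a b := by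
      refine ContinuousOn.intervalIntegrable ?_
      rw [uIcc_of_le hab]
      exact ((continuousOn_const.mul (continuousOn_dctRatioLB n hh)).div continuousOn_id
        fun s hs => ne_of_gt hs).mono fun u hu => hIcc u hu
    have hint2 : IntervalIntegrable (fun u => 2 * dctRatioConst d (tvol d n z) u h / u) volume a b := by
      refine ContinuousOn.intervalIntegrable ?_
      rw [uIcc_of_le hab]
      exact ((continuousOn_const.mul (continuousOn_dctRatioConst ⟨0, h0⟩ hh)).div continuousOn_id
        fun s hs => ne_of_gt hs).mono fun u hu => hIcc u hu
    have hexp : Real.exp (-∫ u in a..b, 2 * dctRatioConst d (tvol d n z) u h / u) ≤ E := by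
      simp only [hE]
      refine Real.exp_le_exp.2 (neg_le_neg (integral_mono_on hab hint1 hint2 fun u hu => ?_))
      have hu0 := hIcc u hu
      exact div_le_div_of_nonneg_right
        (mul_le_mul_of_nonneg_left (dctRatioLB_le_dctRatioConst_tvol hz hu0 hh) zero_le_two) hu0.le
    -- the error term: `max(ε, 0) = ε`
    have hmax : ∫ u in a..b, max (dctBoundaryError d (tvol d n z) u h) 0 =
        ∫ u in a..b, dctBoundaryError d (tvol d n z) u h := by
      refine integral_congr fun u hu => ?_
      rw [uIcc_of_le hab] at hu
      exact max_eq_left (dctBoundaryError_nonneg h0 (hIcc u hu).le hh.le)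
    rw [hmax] at hvol
    linarith
  -- average over `z ∈ Λ_n`
  have hcard : (0 : ℝ) < #(box d n) := by exact_mod_cast (box_nonempty d n).card_pos
  have hsum := sum_le_sum hz_ineq
  rw [sum_const, nsmul_eq_mul, sum_add_distrib, sum_const, nsmul_eq_mul] at hsum
  -- exchange sum and integral, and bound the integrand uniformly
  have hint : ∀ z ∈ box d n, IntervalIntegrable (fun u => dctBoundaryError d (tvol d n z) u h) volume a b := by
    intro z hz
    refine ContinuousOn.intervalIntegrable ?_
    rw [uIcc_of_le hab]
    exact (continuousOn_dctBoundaryError _ h).mono fun u hu => hIcc u hu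
  have hexch : ∑ z ∈ box d n, ∫ u in a..b, dctBoundaryError d (tvol d n z) u h =
      ∫ u in a..b, ∑ z ∈ box d n, dctBoundaryError d (tvol d n z) u h :=
    (integral_finsetSum hint).symm
  have hcontsum : ContinuousOn (fun u => ∑ z ∈ box d n, dctBoundaryError d (tvol d n z) u h)
      (uIcc a b) := by
    rw [uIcc_of_le hab]
    exact continuousOn_finsetSum _ fun z _ =>
      (continuousOn_dctBoundaryError _ h).mono fun u hu => hIcc u hu
  have hbd : ∫ u in a..b, ∑ z ∈ box d n, dctBoundaryError d (tvol d n z) u h ≤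
      ∫ _u in a..b, 8 * d / h * (#(annulus d (2 * n - 1) (2 * n)) : ℝ) :=
    integral_mono_on hab hcontsum.intervalIntegrable intervalIntegrable_const fun u hu =>
      sum_dctBoundaryError_tvol_le hghs hn (hIcc u hu) hh
  rw [hexch] at hsum
  have hC : ∫ _u in a..b, 8 * d / h * (#(annulus d (2 * n - 1) (2 * n)) : ℝ) =
      (b - a) * (8 * d / h * #(annulus d (2 * n - 1) (2 * n))) := by
    rw [intervalIntegral.integral_const, smul_eq_mul]
  set K : ℝ := (b - a) * (8 * d / h * #(annulus d (2 * n - 1) (2 * n))) with hK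
  have htot : (#(box d n) : ℝ) * (1 - dctMag d (box d (4 * n)) b h ^ 2) ≤ #(box d n) * E + K := by
    linarith [hsum, hbd, hC]
  have key : 1 - dctMag d (box d (4 * n)) b h ^ 2 ≤ E + K / #(box d n) := by
    calc 1 - dctMag d (box d (4 * n)) b h ^ 2
        = (#(box d n) : ℝ) * (1 - dctMag d (box d (4 * n)) b h ^ 2) / #(box d n) := by
          field_simp
      _ ≤ ((#(box d n) : ℝ) * E + K) / #(box d n) := div_le_div_of_nonneg_right htot hcard.le
      _ = E + K / #(box d n) := by
          rw [add_div, mul_div_cancel_left₀ _ hcard.ne']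
  calc 1 - dctMag d (box d (4 * n)) b h ^ 2 ≤ E + K / #(box d n) := key
    _ = _ := by simp only [hK, hE]; ring

/-- **Passing to the limit `n → ∞` in the averaged inequality** (Duminil-Copin–Tassion 2016, §2.4,
from (2.9)–(2.10) to the display before "Inequality (2.6) follows by letting `h` tend to `0`",
without the `ε → 0` input): granting the corrected Lemma 2.6 and GHS concavity, for
`0 < β₁ < a ≤ b`, `h > 0` and `φ_s(S) ≥ 1` (`s > β₁`, `S ∋ 0`), `1 - ⟨σ₀⟩²_{b,h} ≤ (a/b)²`. [cite: DuminilCopinTassionCMP2016, §2.4, eqs. (2.9)–(2.10) and the following display (arXiv:1502.03050 numbering), with the Correction CMP 359 (2018) 821] -/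
theorem one_sub_dctMagInf_sq_le_avg (hdi : dct_meanField_differentialInequality (d := d))
    (hghs : ghs_concaveOn_isingCorr_free_singleton) (hd : 1 ≤ d)
    {β₁ a b h : ℝ} (hβ₁ : 0 < β₁) (ha : β₁ < a) (hab : a ≤ b) (hh : 0 < h)
    (hφ : ∀ s : ℝ, β₁ < s → ∀ S : Finset (Site d), (0 : Site d) ∈ S → 1 ≤ dctIsingPhi d s S) :
    1 - dctMagInf d b h ^ 2 ≤ (a / b) ^ 2 := by
  have ha0 : 0 < a := hβ₁.trans ha
  have hb0 : 0 < b := ha0.trans_le hab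
  have hIoc : ∀ u ∈ Ioc a b, 0 < u := fun u hu => ha0.trans hu.1
  -- the left-hand side along `Λ_{4n}`
  have hLHS : Tendsto (fun n : ℕ => 1 - dctMag d (box d (4 * n)) b h ^ 2) atTop
      (𝓝 (1 - dctMagInf d b h ^ 2)) := by
    have h4 : Tendsto (fun n : ℕ => dctMag d (box d (4 * n)) b h) atTop (𝓝 (dctMagInf d b h)) :=
      (tendsto_dctMag_box hb0 hh.le).comp (tendsto_id.const_mul_atTop' (by norm_num : (0 : ℕ) < 4))
    exact (h4.pow 2).const_sub 1
  -- the exponential term, by dominated convergence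
  have hI : Tendsto (fun n : ℕ => ∫ u in a..b, 2 * dctRatioLB d n u h / u) atTop
      (𝓝 (∫ u in a..b, 2 / u)) := by
    refine intervalIntegral.tendsto_integral_filter_of_dominated_convergence (fun _ => 2 / a)
      (Eventually.of_forall fun n => ?_) (Eventually.of_forall fun n => ae_of_all _ fun u hu => ?_)
      intervalIntegrable_const (ae_of_all _ fun u hu => ?_)
    · refine ContinuousOn.aestronglyMeasurable ?_ measurableSet_uIoc
      rw [uIoc_of_le hab]
      exact ((continuousOn_const.mul (continuousOn_dctRatioLB n hh)).div
        continuousOn_id fun s hs => (ne_of_gt hs)).mono fun u hu => hIoc u hu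
    · rw [uIoc_of_le hab] at hu
      have hu0 := hIoc u hu
      have hc0 := dctRatioLB_nonneg (d := d) n hu0 hh
      have hc1 := dctRatioLB_le_one (d := d) n hu0 hh
      rw [Real.norm_eq_abs, abs_of_nonneg (div_nonneg (by positivity) hu0.le)]
      calc 2 * dctRatioLB d n u h / u ≤ 2 * 1 / u := by gcongr
        _ ≤ 2 / a := by rw [mul_one]; exact div_le_div_of_nonneg_left zero_le_two ha0 hu.1.le
    · rw [uIoc_of_le hab] at hu
      have hu0 := hIoc u hu
      have := ((tendsto_dctRatioLB (d := d) hu0 hh).const_mul 2).div_const u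
      simpa using this
  have hIval : ∫ u in a..b, (2 : ℝ) / u = 2 * Real.log (b / a) := by
    have : (fun u : ℝ => (2 : ℝ) / u) = fun u => 2 * u⁻¹ := funext fun u => div_eq_mul_inv _ _
    rw [this, intervalIntegral.integral_const_mul, integral_inv_of_pos ha0 hb0]
  -- the averaged error term
  have hJ : Tendsto (fun n : ℕ =>
      (b - a) * (8 * d / h * ((#(annulus d (2 * n - 1) (2 * n)) : ℝ) / #(box d n)))) atTop
      (𝓝 ((b - a) * (8 * d / h * 0))) :=
    ((tendsto_card_boundary_div_card_box hd).const_mul _).const_mul _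
  rw [mul_zero, mul_zero] at hJ
  have hRHS : Tendsto (fun n : ℕ =>
      Real.exp (-∫ u in a..b, 2 * dctRatioLB d n u h / u) +
        (b - a) * (8 * d / h * ((#(annulus d (2 * n - 1) (2 * n)) : ℝ) / #(box d n)))) atTop
      (𝓝 (Real.exp (-(2 * Real.log (b / a))) + 0)) := by
    rw [← hIval]
    exact ((Real.continuous_exp.tendsto _).comp hI.neg).add hJ
  have hle := le_of_tendsto_of_tendsto' (hLHS.comp (tendsto_add_atTop_nat 1))
    (hRHS.comp (tendsto_add_atTop_nat 1)) fun n =>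
    one_sub_dctMag_sq_le_avg hdi hghs hd hβ₁ ha hab hh hφ (Nat.le_add_left 1 n)
  have hexp : Real.exp (-(2 * Real.log (b / a))) = (a / b) ^ 2 := by
    have h2 : Real.exp (2 * Real.log (b / a)) = (b / a) ^ 2 := by
      rw [show (2 : ℝ) * Real.log (b / a) = Real.log (b / a) + Real.log (b / a) by ring,
        Real.exp_add, Real.exp_log (by positivity)]
      ring
    rw [Real.exp_neg, h2]
    field_simp
  rw [hexp, add_zero] at hle
  exact hle

end Limit

/-! ### Eq. (2.6) and crit-ising.S08 from the corrected Lemma 2.6 and GHS concavity -/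

section Assembly

/-- **Duminil-Copin–Tassion 2016, eq. (2.6), from the corrected Lemma 2.6 and GHS concavity
alone.** Granting `dct_meanField_differentialInequality` and `ghs_concaveOn_isingCorr_free_singleton`,
the named fact `dct_magnetization_lower_bound` holds: for `d ≥ 1`, `0 < β₁ ≤ β` with
`φ_{β'}(S) ≥ 1` for all `β' > β₁`, `S ∋ 0`, `m*(β) ≥ √((β² - β₁²)/β²)`. The `ε → 0` input of
`dct_magnetization_lower_bound_of_facts` is replaced by the site average
(`one_sub_dctMagInf_sq_le_avg`), and the limit `h ↘ 0` uses only `⟨σ₀⟩^∅_{β,h} ≤ ⟨σ₀⟩⁺_{β,h}`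
(GKS) and the right-continuity `⟨σ₀⟩⁺_{β,h} → m*(β)` (Friedli–Velenik 2017, Lemma 3.31 (1)). [cite: DuminilCopinTassionCMP2016, §2.4, eq. (2.6) (arXiv:1502.03050 numbering)] [cite: FriedliVelenik2017, Lemma 3.31 (1), p. 119, and Exercise 3.25, p. 132] -/
theorem dct_magnetization_lower_bound_of_diffIneq (hdi : dct_meanField_differentialInequality (d := d))
    (hghs : ghs_concaveOn_isingCorr_free_singleton) : dct_magnetization_lower_bound (d := d) := by
  intro hd β₁ β hβ₁ hle hφ
  have hβ : 0 < β := hβ₁.trans_le hle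
  -- lower bound on `M(β, h)` for every `h > 0`
  have hM : ∀ h : ℝ, 0 < h → Real.sqrt ((β ^ 2 - β₁ ^ 2) / β ^ 2) ≤ dctMagInf d β h := by
    intro h hh
    have hMpos : 0 < dctMagInf d β h := dctMagInf_pos hβ hh
    rcases eq_or_lt_of_le hle with heq | hlt
    · rw [heq, sub_self, zero_div, Real.sqrt_zero]
      exact hMpos.le
    · have hbound : ∀ a ∈ Ioo β₁ β, 1 - (a / β) ^ 2 ≤ dctMagInf d β h ^ 2 := by
        intro a ha
        have := one_sub_dctMagInf_sq_le_avg hdi hghs hd hβ₁ ha.1 ha.2.le hh hφ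
        linarith
      have hlimit : 1 - (β₁ / β) ^ 2 ≤ dctMagInf d β h ^ 2 := by
        have hcont : Tendsto (fun a : ℝ => 1 - (a / β) ^ 2) (𝓝[>] β₁) (𝓝 (1 - (β₁ / β) ^ 2)) := by
          refine tendsto_nhdsWithin_of_tendsto_nhds ?_
          exact ((continuous_const.sub ((continuous_id.div_const β).pow 2)).tendsto β₁)
        refine le_of_tendsto hcont ?_
        have hev : ∀ᶠ a in 𝓝[>] β₁, a ∈ Ioo β₁ β := Ioo_mem_nhdsGT hlt
        filter_upwards [hev] with a ha using hbound a ha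
      have hsq : (β ^ 2 - β₁ ^ 2) / β ^ 2 = 1 - (β₁ / β) ^ 2 := by
        field_simp
      rw [hsq]
      calc Real.sqrt (1 - (β₁ / β) ^ 2) ≤ Real.sqrt (dctMagInf d β h ^ 2) := Real.sqrt_le_sqrt hlimit
        _ = dctMagInf d β h := Real.sqrt_sq hMpos.le
  -- `⟨σ₀⟩^∅_{β,k} ≤ ⟨σ₀⟩⁺_{β,k}` for every `k > 0`
  have hplus : ∀ k : ℝ, 0 < k → Real.sqrt ((β ^ 2 - β₁ ^ 2) / β ^ 2) ≤ plusCorr d β k {0} := by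
    intro k hk
    have h1 := hM (β * k) (mul_pos hβ hk)
    rw [dctMagInf, mul_div_cancel_left₀ _ hβ.ne'] at h1
    exact h1.trans (freeCorr_le_plusCorr hβ.le hk.le {0})
  -- `k ↘ 0` by right-continuity of the plus state
  have hrc := plusCorr_continuousWithinAt_Ici_field (d := d) hβ.le {0} le_rfl
  have hlim : Tendsto (fun k : ℝ => plusCorr d β k {0}) (𝓝[>] 0) (𝓝 (spontaneousMagnetization d β)) := by
    rw [spontaneousMagnetization_eq_plusCorr]
    exact hrc.tendsto.mono_left (nhdsWithin_mono _ Set.Ioi_subset_Ici_self)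
  refine ge_of_tendsto hlim ?_
  filter_upwards [self_mem_nhdsWithin] with k hk using hplus k hk

/-- **crit-ising.S08 from the corrected Lemma 2.6 and GHS concavity** (everything else being
proved in the tree: the modified Simon inequality, GKS, the existence of the free and plus
states, translation covariance, the iteration of `SharpnessSubcritical`, and the present
assembly). [cite: DuminilCopinTassionCMP2016, Thm. 2.1 (third item), §2.4–2.5 (arXiv:1502.03050 numbering)] [cite: AizenmanBarskyFernandezJSP1987, Thm. 1] -/
theorem twoPoint_exponentialDecay_of_diffIneq (hdi : dct_meanField_differentialInequality (d := d))
    (hghs : ghs_concaveOn_isingCorr_free_singleton) :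
    twoPoint_exponentialDecay_of_lt_criticalBeta (d := d) :=
  twoPoint_exponentialDecay_of_dct_magnetization_lower_bound
    (dct_magnetization_lower_bound_of_diffIneq hdi hghs)

/-- **Duminil-Copin–Tassion 2016, eq. (2.6), from the corrected Lemma 2.6 alone**, the GHS
concavity being proved in `GHSInequality` (`ghs_concaveOn_isingCorr_free_singleton_holds`). [cite: DuminilCopinTassionCMP2016, §2.4, eq. (2.6) and Lemma 2.6 (arXiv:1502.03050 numbering), with the Correction CMP 359 (2018) 821] -/
theorem dct_magnetization_lower_bound_of_differentialInequality
    (hdi : dct_meanField_differentialInequality (d := d)) : dct_magnetization_lower_bound (d := d) :=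
  dct_magnetization_lower_bound_of_diffIneq hdi ghs_concaveOn_isingCorr_free_singleton_holds

/-- **crit-ising.S08 from the corrected Lemma 2.6 alone.** [cite: DuminilCopinTassionCMP2016, Thm. 2.1 (third item) and Lemma 2.6 (arXiv:1502.03050 numbering), with the Correction CMP 359 (2018) 821] [cite: AizenmanBarskyFernandezJSP1987, Thm. 1] -/
theorem twoPoint_exponentialDecay_of_differentialInequality
    (hdi : dct_meanField_differentialInequality (d := d)) :
    twoPoint_exponentialDecay_of_lt_criticalBeta (d := d) :=
  twoPoint_exponentialDecay_of_diffIneq hdi ghs_concaveOn_isingCorr_free_singleton_holds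

end Assembly

end Literature.Probability.LatticeModels
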